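import Literature.MathematicalPhysics.QuantumManyBody.SwapEntropy
import HarnessLib

/-!
# Accessible swap mass of an a.e. nonvanishing Dirichlet wave function

Helper for item `GroundStateAccessible` (stmt-AtomisticToContinuum-12069) of route `BECInsertionVariance`
(`Summit.AtomisticToContinuum.BoseEinsteinCondensation.Theses.BECInsertionVariance.GroundStateAccessible`).

If a real wave function `Φ` of `n + 1` particles vanishes off the box `Λ_L^{n+1}` (Dirichlet) and is
NONZERO at almost every point of the box, then the accessible set `{q ≠ 0}` of the two-replica picture
(`Literature.MathematicalPhysics.QuantumManyBody.BoseGas.swapMass`, `q = p ∘ T` the swapped density)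
carries all of the mass of `p = Φ² ⊗ Φ²`: `swapMass n Φ = ∫∫ p = (∫ Φ²)²`
(`swapMass_eq_lintegral_replicaDensity_of_ae_ne_zero`, `swapMass_eq_sq_of_ae_ne_zero`), hence `= 1`
for normalised `Φ` (`swapMass_eq_one_of_ae_ne_zero`). This is the "finite `v`" (no hard core) branch
of the item: there the nonnegative Dirichlet ground state is strictly positive on the open box
(Perron–Frobenius), so the teleported boson always lands on an allowed configuration.

Proof: `p ≠ 0` at `Z = (X, Y)` forces `X, Y ∈ Λ^{n+1}` (Dirichlet), hence both swapped
configurations `X[0 ↦ y₀]`, `Y[0 ↦ x₀]` lie in `Λ^{n+1}`; the replica swap `T` preserves Lebesgue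
measure (`measurePreserving_replicaSwap`), so for a.e. `Z` the function `Φ` is nonzero at both swapped
configurations whenever they lie in the box; thus `p = 𝟙_{q ≠ 0} p` a.e.
-/

noncomputable section

open MeasureTheory Filter Set
open scoped ENNReal NNReal

namespace Summit.AtomisticToContinuum.BoseEinsteinCondensation.Theorems.BECInsertionVariance

open Literature.MathematicalPhysics.QuantumManyBody.BoseGas

variable {n : ℕ}

/-- Replacing particle `0` of a configuration in the box by a point of the box stays in the box.
[folklore] -/
theorem update_zero_mem_boxN {L : ℝ} {X : Config (n + 1)} (hX : X ∈ boxN (n + 1) L) {y : Space}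
    (hy : y ∈ box L) : Function.update X 0 y ∈ boxN (n + 1) L := by
  intro i
  rcases eq_or_ne i 0 with rfl | hi
  · simpa using hy
  · rw [Function.update_of_ne hi]
    exact hX i

/-- Transport of an a.e. property of one configuration to the four configurations of the two-replica
picture: both replicas and both swapped replicas (the coordinate projections and the replica swap are
quasi-measure-preserving). [folklore] -/
theorem ae_replica_of_ae {P : Config (n + 1) → Prop} (h : ∀ᵐ X : Config (n + 1), P X) :
    ∀ᵐ Z : Config (n + 1) × Config (n + 1),
      P Z.1 ∧ P Z.2 ∧ P (replicaSwap Z).1 ∧ P (replicaSwap Z).2 := by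
  have h12 : ∀ᵐ Z : Config (n + 1) × Config (n + 1), P Z.1 ∧ P Z.2 := by
    rw [Measure.volume_eq_prod]
    exact (Measure.quasiMeasurePreserving_fst.ae h).and (Measure.quasiMeasurePreserving_snd.ae h)
  have hT : ∀ᵐ Z : Config (n + 1) × Config (n + 1), P (replicaSwap Z).1 ∧ P (replicaSwap Z).2 :=
    (measurePreserving_replicaSwap (n := n)).quasiMeasurePreserving.ae h12
  filter_upwards [h12, hT] with Z hZ hTZ
  exact ⟨hZ.1, hZ.2, hTZ.1, hTZ.2⟩

/-- **All of the two-replica mass is accessible when `Φ` does not vanish on the box.** For a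
measurable real `Φ` on `(ℝ³)^{n+1}` vanishing off `Λ_L^{n+1}` and nonzero at a.e. point of
`Λ_L^{n+1}`: `swapMass n Φ = ∫∫ p`, `p = Φ² ⊗ Φ²`. [folklore] -/
theorem swapMass_eq_lintegral_replicaDensity_of_ae_ne_zero {Φ : Config (n + 1) → ℝ}
    (hΦ : Measurable Φ) {L : ℝ} (h0 : ∀ X, X ∉ boxN (n + 1) L → Φ X = 0)
    (hne : ∀ᵐ X : Config (n + 1), X ∈ boxN (n + 1) L → Φ X ≠ 0) :
    swapMass n Φ = ∫⁻ Z, ENNReal.ofReal (replicaDensity Φ Z) := by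
  -- a.e. in `Z`: `p Z ≠ 0 → q Z ≠ 0`
  have hae : ∀ᵐ Z : Config (n + 1) × Config (n + 1),
      ENNReal.ofReal (replicaDensity Φ Z) =
        {Z | swappedDensity Φ Z ≠ 0}.indicator (fun Z => ENNReal.ofReal (replicaDensity Φ Z)) Z := by
    filter_upwards [ae_replica_of_ae hne] with Z hZ
    by_cases hp : replicaDensity Φ Z = 0
    · simp [Set.indicator_apply, hp]
    · obtain ⟨h1, h2⟩ := (replicaDensity_ne_zero_iff Φ Z).1 hp
      have hX : Z.1 ∈ boxN (n + 1) L := by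
        by_contra hX; exact h1 (h0 _ hX)
      have hY : Z.2 ∈ boxN (n + 1) L := by
        by_contra hY; exact h2 (h0 _ hY)
      have hq : swappedDensity Φ Z ≠ 0 := by
        rw [swappedDensity_ne_zero_iff]
        exact ⟨hZ.2.2.1 (update_zero_mem_boxN hX (hY 0)), hZ.2.2.2 (update_zero_mem_boxN hY (hX 0))⟩
      rw [indicator_of_mem (show Z ∈ {Z | swappedDensity Φ Z ≠ 0} from hq)]
  rw [swapMass, ← lintegral_indicator (measurableSet_swappedDensity_ne_zero hΦ)]
  exact (lintegral_congr_ae hae).symm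

/-- Same, evaluated: `swapMass n Φ = (∫ Φ²)²`. [folklore] -/
theorem swapMass_eq_sq_of_ae_ne_zero {Φ : Config (n + 1) → ℝ} (hΦ : Measurable Φ) {L : ℝ}
    (h0 : ∀ X, X ∉ boxN (n + 1) L → Φ X = 0)
    (hne : ∀ᵐ X : Config (n + 1), X ∈ boxN (n + 1) L → Φ X ≠ 0) :
    swapMass n Φ = (∫⁻ X, ENNReal.ofReal (Φ X ^ 2)) ^ 2 := by
  rw [swapMass_eq_lintegral_replicaDensity_of_ae_ne_zero hΦ h0 hne, lintegral_replicaDensity hΦ]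

/-- **Normalised case.** If moreover `∫ Φ² = 1` (in the form `∫ (ofReal Φ)² = 1` of
`lintegral_groundState_sq`, for `Φ ≥ 0`), then `swapMass n Φ = 1`. [folklore] -/
theorem swapMass_eq_one_of_ae_ne_zero {Φ : Config (n + 1) → ℝ} (hΦ : Measurable Φ)
    (hnn : ∀ X, 0 ≤ Φ X) {L : ℝ} (h0 : ∀ X, X ∉ boxN (n + 1) L → Φ X = 0)
    (hne : ∀ᵐ X : Config (n + 1), X ∈ boxN (n + 1) L → Φ X ≠ 0)
    (h1 : ∫⁻ X, ENNReal.ofReal (Φ X) ^ 2 = 1) : swapMass n Φ = 1 := by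
  have h1' : ∫⁻ X, ENNReal.ofReal (Φ X ^ 2) = 1 := by
    rw [← h1]
    exact lintegral_congr fun X => ENNReal.ofReal_pow (hnn X) 2
  rw [swapMass_eq_sq_of_ae_ne_zero hΦ h0 hne, h1', one_pow]

end Summit.AtomisticToContinuum.BoseEinsteinCondensation.Theorems.BECInsertionVariance

end
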